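import Summits.Ventures.YMGap.Conjectures.StrongCouplingChiralLRO
import Literature.MathematicalPhysics.QuantumLattice.StrongCouplingDeterminantRepresentation
import HarnessLib
import HarnessLib.Audit.Tags

/-!
# Venture YMGap — Conjectures/StrongCouplingChiralLROZeroCoupling.lean: the `β = 0` SLICE of the typed
# conjecture `SalmhoferSeilerSmallBeta` (ladder rung Q1, Y3) IS A THEOREM — Salmhofer–Seiler Cor. 4.9 in the
# conjecture's own vocabulary

HONEST FRAMING (venture `Summits/Ventures/YMGap`, cell `pub-ymgap`, seat qcd-lit g17, `bears_on: Q1`).  The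
conjecture `Summit.Ventures.YMGap.Conjectures.SalmhoferSeilerSmallBeta` (`Conjectures/StrongCouplingChiralLRO.lean`)
asks, for `1 ≤ N ≤ 4` and `ν ≥ 4`, for `β₀ > 0`, `c > 0`, `L₀` with `c ≤ ssChiralOrder N ν L β` for all
`0 ≤ β < β₀` and all even `L ≥ L₀`: chiral long-range order of `U(N)` lattice gauge theory with massless
staggered fermions, uniformly in the volume, at SMALL POSITIVE `β`.  That is NOT proved here and remains open
(not in print).  This file proves exactly its `β = 0` member, with the SAME body:

* **`salmhoferSeiler_betaZero`** — `∀ N ν, 1 ≤ N → N ≤ 4 → 4 ≤ ν → ∃ c > 0, ∃ L₀, ∀ L [NeZero L], Even L →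
  L₀ ≤ L → c ≤ ssChiralOrder N ν L 0`.

So the conjecture's docstring sentence «at `β = 0` this is the uniform content of the printed proof of Cor. 4.9
((4.41)–(4.43))» is now kernel-checked, INCLUDING the conjecture's junk conventions: `ssChiralOrder` is written
with the fermions integrated out — the Haar integral (`wilsonWeight ρ 0`) of `Re det D₀[U]` times the Wick
contraction of `ψ̄ψ(0)ψ̄ψ(x)` with the propagator `D₀[U]⁻¹` (Mathlib's `Matrix.inv`, junk `0` when `D₀[U]` is
singular) over the integral of `Re det D₀[U]`.  The identification with Salmhofer–Seiler's Berezin–Haar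
expectation (2.10) is the Literature theorem
`Literature.MathematicalPhysics.QuantumLattice.StrongCoupling.chiralLRO_detRep` (module
`StrongCouplingDeterminantRepresentation`), which rests on (i) the gauge-level Cor. 4.9
`StrongCoupling.chiralLRO_gauge_staggered` (bosonisation (2.21) + the complex-spin theorems of the tree, modules
`StrongCouplingBosonisation`, `ComplexSpin*`), (ii) the fermionic Wick rule
(`GrassmannAlgebra.berezin_grassmannExp_quadratic_mul_prod`), and (iii) the Haar-nullity of the singular set
`{U : det D₀[U] = 0}` (`StaggeredSingular.measure_pi_setOf_det_staggeredDirac_eq_zero`, module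
`StaggeredDiracSingularSetNull` — the conjecture file's paragraph «JUNK CONVENTIONS», proved).  This file only
unfolds the conjecture's definitions `ssChiralOrder`, `ssTwoPoint`, `ssPartitionFunction`, `ssFermionDet`,
`ssWick`, `ssDirac` onto that theorem.

WHAT THIS IS NOT: not the conjecture (`β > 0` is untouched: no `β`-expansion, no infrared bound at `β > 0` —
census S1–S6 of the conjecture's docstring unchanged); nothing about `SU(N)`, Wilson fermions, the continuum,
`IsChiralAtZero`, a mass gap, or the Clay problem.  No facts, no `sorry`.

Reference: M. Salmhofer, E. Seiler, Commun. Math. Phys. 139 (1991) 395–432, Cor. 4.9 with (2.10)–(2.11) and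
(4.41)–(4.43) [SalmhoferSeiler1991].
-/

noncomputable section

namespace Summit.Ventures.YMGap.Conjectures

open Literature.MathematicalPhysics.QuantumLattice

/-- **The `β = 0` slice of `SalmhoferSeilerSmallBeta` (Salmhofer–Seiler Cor. 4.9, uniform finite-volume form,
in the determinant/propagator vocabulary of the conjecture).**  For `1 ≤ N ≤ 4` and `ν ≥ 4` there are `c > 0`
and `L₀` such that for every even `L ≥ L₀` the `β = 0`, `m = 0` `U(N)` lattice gauge theory with staggered
fermions on `(ℤ/Lℤ)^ν` satisfies `|Λ_L|⁻¹ ∑_x ⟨ψ̄ψ(0) ψ̄ψ(x)⟩_{Λ_L, 0, 0} ≥ c`, the two-point function being the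
conjecture's `ssTwoPoint` (Haar integral of `Re det D₀[U]` times the Wick contraction with `D₀[U]⁻¹`, over
`∫ Re det D₀[U]`). [cite: SalmhoferSeiler1991, Cor. 4.9 with (2.10)–(2.11) and (4.41)–(4.43)] -/
theorem salmhoferSeiler_betaZero :
    ∀ N ν : ℕ, 1 ≤ N → N ≤ 4 → 4 ≤ ν →
      ∃ c : ℝ, 0 < c ∧ ∃ L₀ : ℕ, ∀ (L : ℕ) [NeZero L], Even L → L₀ ≤ L → c ≤ ssChiralOrder N ν L 0 := by
  intro N ν hN1 hN4 hν
  obtain ⟨c, hc, L₀, h⟩ := StrongCoupling.chiralLRO_detRep (N := N) (ν := ν) hN1 hN4 hν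
  exact ⟨c, hc, L₀, fun L _ hE hL => h L hE hL⟩

end Summit.Ventures.YMGap.Conjectures

end
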